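import Mathlib.GroupTheory.Coset.Card
import Mathlib.GroupTheory.QuotientGroup.Defs
import Mathlib.Algebra.Order.BigOperators.Ring.Finset
import Mathlib.Data.Fintype.BigOperators
import Mathlib.Data.Finset.Max
import Mathlib.Data.Real.Basic
import Mathlib.Tactic.Group
import HarnessLib

/-!
# Tate's almost étale lemma — the finite-group bookkeeping (Serre IV §1 Prop. 3 in "`Σ`-`min`" form)

This file isolates the COMBINATORIAL core of an elementary proof of Tate's theorem (Tate 1967,
§3.2 Prop. 9: for the cyclotomic tower `K_∞ = K(μ_{p^∞})` of a `p`-adic field and a finite extension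
`M/K_∞`, `Tr_{M/K_∞}(𝓞_M) ⊇ 𝔪_{K_∞}`), in a form that uses NEITHER the different NOR Herbrand's
upper numbering.

Setting (abstracted from the Galois situation `G = Gal(Ω/ℚ_p)`, `Ω = E(ζ_{p^n})`, `𝓞_Ω = ℤ_p[x]`,
`N g = ‖g x − x‖`): a finite group `G` and a real-valued gauge `N : G → ℝ` with `N 1 = 0`,
`0 ≤ N ≤ 1`, `N g⁻¹ = N g` and the ultrametric rule `N (g h) ≤ max (N g) (N h)` (these hold for
`g ↦ ‖g x − x‖` under an isometric action).  For a subgroup `C` put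
`P_C(U) = ∏_{τ ∈ C} max (N τ) U`.  We prove:

* `apply_mul_eq_max_of_forall_le` (Serre IV §1, the "maximal representative" trick of the proof of
  Herbrand's theorem): if `s` minimises `N` on its coset `s C` then `N (s t) = max (N s) (N t)` on `C`;
* `prod_max_le_prod_max_coset` : every coset product dominates `P_C`:
  `P_C(U) ≤ ∏_{τ ∈ C} max (N (σ τ)) U`;
* `prod_eq_prod_quotient_prod_subgroup` : `∏_{g ∈ G} f g = ∏_{q ∈ G/C} ∏_{τ ∈ C} f (q.out τ)`;
* `prod_max_pow_index_le` : `P_C(U)^{[G:C]} ≤ P_G(U)`;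
* `prod_max_le_max_prod` : `∏ max (a_i) U ≤ max (∏ a_i) U` on `[0,1]`, whence
  `prod_max_univ_le_prod_quotient` : `P_G(U) ≤ ∏_{q ∈ G/H, q ≠ 1} max (∏_{h ∈ H} N (q.out h)) U`;
* `le_prod_max_of_le_prod_mul` : a lower bound `J ≤ ∏_{τ∈C} N (σ τ)` (`σ ∉ C`) gives `J ≤ P_C(N σ)`;
* `lt_apply_of_prod_max_univ_lt` (the punch line): if `J ≤ ∏_{τ ∈ C} N (σ τ)` for all `σ ∉ C` and
  `P_G(U₀) < J^{[G:C]}` then `U₀ < N σ` for every `σ ∉ C`.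

In the application `C = Gal(Ω/E)`, the lower bound `J` is the distance from a generator `y₀` of
`𝓞_E`-over-`ℚ_p`… (precisely: of `E/ℚ_p`) to its other conjugates, the upper bound for `P_G(U₀)`
comes from `H = Gal(Ω/ℚ_p(ζ_{p^n}))` and the explicit integers `ℤ_p[ζ_{p^n}]`, and the conclusion
says that the non-trivial elements of `Gal(Ω/ℚ_p(ζ_{p^n}))` move the generator `x` by almost units —
which is the decay of the different `𝔇(Ω/ℚ_p(ζ_{p^n}))` (Tate 1967 §3.2; Serre, *Local Fields* IV §1
Prop. 3, §3 Lemma 5).  Pure finite-group / real-number bookkeeping; no field appears here.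

References: J. Tate, *p-divisible groups* (1967) §3.2 [Tate1967]; J.-P. Serre, *Local Fields*,
Ch. IV §1 Prop. 2–3, §3 Lemmas 3–5 [SerreLocalFields1979].
-/

noncomputable section

open scoped Classical
open Finset

namespace Literature.NumberTheory.PAdicHodge.TateAlmostEtale

variable {G : Type*} [Group G] [Fintype G]

/-! ## Products over a subgroup and over the whole group -/

/-- Reindexing a product over a subgroup `C` along left multiplication by an element of `C`:
`∏_{τ ∈ C} f (σ τ) = ∏_{τ ∈ C} f (σ c τ)`. [folklore] -/
private theorem prod_subgroup_mul_left (C : Subgroup G) (f : G → ℝ) (σ : G) (c : C) :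
    ∏ τ : C, f (σ * τ) = ∏ τ : C, f (σ * c * τ) := by
  refine Fintype.prod_equiv (Equiv.mulLeft c⁻¹) _ _ (fun τ => ?_)
  simp only [Equiv.coe_mulLeft, Subgroup.coe_mul, Subgroup.coe_inv, mul_assoc, mul_inv_cancel_left]

omit [Fintype G] in
/-- The map `(q, τ) ↦ q.out · τ` from `G/C × C` to `G` is a bijection (a transversal times the
subgroup) — the coset bookkeeping behind Serre's `i_{G/H}(σ) = (1/e') Σ_{s → σ} i_G(s)`.
[cite: SerreLocalFields1979, Ch. IV §1 Prop. 3 (coset bookkeeping of the proof)] -/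
theorem bijective_out_mul (C : Subgroup G) :
    Function.Bijective fun x : (G ⧸ C) × C => x.1.out * (x.2 : G) := by
  constructor
  · rintro ⟨q₁, τ₁⟩ ⟨q₂, τ₂⟩ h
    dsimp only at h
    have hq : q₁ = q₂ := by
      rw [← QuotientGroup.out_eq' q₁, ← QuotientGroup.out_eq' q₂, QuotientGroup.eq]
      have e : q₁.out⁻¹ * q₂.out = (τ₁ : G) * (τ₂ : G)⁻¹ :=
        calc q₁.out⁻¹ * q₂.out = q₁.out⁻¹ * (q₂.out * (τ₂ : G)) * (τ₂ : G)⁻¹ := by group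
          _ = q₁.out⁻¹ * (q₁.out * (τ₁ : G)) * (τ₂ : G)⁻¹ := by rw [h]
          _ = (τ₁ : G) * (τ₂ : G)⁻¹ := by group
      rw [e]
      exact C.mul_mem τ₁.2 (C.inv_mem τ₂.2)
    subst hq
    simp only [Prod.mk.injEq, true_and]
    exact Subtype.ext (mul_left_cancel h)
  · intro g
    obtain ⟨c, hc⟩ := QuotientGroup.mk_out_eq_mul C g
    refine ⟨((QuotientGroup.mk g : G ⧸ C), c⁻¹), ?_⟩
    simp only [hc, Subgroup.coe_inv, mul_inv_cancel_right]

/-- **Coset decomposition of a product**: `∏_{g ∈ G} f g = ∏_{q ∈ G/C} ∏_{τ ∈ C} f (q.out · τ)`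
(the grouping `Σ_{s ∈ G} = Σ_{σ ∈ G/H} Σ_{s → σ}` of Serre's Prop. 3, multiplicatively).
[cite: SerreLocalFields1979, Ch. IV §1 Prop. 3 (coset bookkeeping of the proof)] -/
theorem prod_eq_prod_quotient_prod_subgroup (C : Subgroup G) (f : G → ℝ) :
    ∏ g : G, f g = ∏ q : G ⧸ C, ∏ τ : C, f (q.out * τ) := by
  rw [← Fintype.prod_prod_type' (f := fun (q : G ⧸ C) (τ : C) => f (q.out * τ))]
  exact (Fintype.prod_bijective _ (bijective_out_mul C) (fun x => f (x.1.out * (x.2 : G))) f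
    (fun _ => rfl)).symm

/-! ## The gauge: minimal representatives and coset products -/

section Gauge

variable (N : G → ℝ)

/-- **Minimal representatives exist**: every coset `σ C` contains an element `s = σ τ₀` minimising
`N` on the coset, i.e. `N s ≤ N (s τ)` for all `τ ∈ C`. [folklore] -/
private theorem exists_minRep (C : Subgroup G) (σ : G) :
    ∃ c : C, ∀ τ ∈ C, N (σ * c) ≤ N (σ * c * τ) := by
  obtain ⟨τ₀, hτ₀, hmin⟩ := (Finset.univ.filter (· ∈ C)).exists_min_image (fun τ => N (σ * τ))
    ⟨1, by simp [C.one_mem]⟩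
  refine ⟨⟨τ₀, (Finset.mem_filter.mp hτ₀).2⟩, fun τ hτ => ?_⟩
  rw [mul_assoc]
  exact hmin (τ₀ * τ) (Finset.mem_filter.mpr ⟨Finset.mem_univ _, C.mul_mem (Finset.mem_filter.mp hτ₀).2 hτ⟩)

variable (hmul : ∀ g h : G, N (g * h) ≤ max (N g) (N h)) (hinv : ∀ g : G, N g⁻¹ = N g)
include hmul hinv

omit [Fintype G] in
/-- **Serre's maximal-representative trick** (proof of Herbrand's theorem, *Local Fields* IV §3
Lemma 5, in multiplicative form): if `s` minimises the ultrametric gauge `N` on its coset `s C`, then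
`N (s t) = max (N s) (N t)` for every `t ∈ C`. [cite: SerreLocalFields1979, Ch. IV §3 Lemma 5] -/
theorem apply_mul_eq_max_of_forall_le (C : Subgroup G) {s : G}
    (hs : ∀ τ ∈ C, N s ≤ N (s * τ)) {t : G} (ht : t ∈ C) : N (s * t) = max (N s) (N t) := by
  refine le_antisymm (hmul s t) (max_le (hs t ht) ?_)
  have h1 : N t ≤ max (N s⁻¹) (N (s * t)) := by
    have := hmul s⁻¹ (s * t)
    rwa [inv_mul_cancel_left] at this
  rw [hinv] at h1
  rcases le_max_iff.mp h1 with h | h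
  · exact h.trans (hs t ht)
  · exact h

variable (hnn : ∀ g : G, 0 ≤ N g)
include hnn

/-- **Every coset product dominates the subgroup product**: for all `σ` and `U`,
`∏_{τ ∈ C} max (N τ) U ≤ ∏_{τ ∈ C} max (N (σ τ)) U` (choose `σ` minimal in its coset; then
`N (σ τ) = max (N σ) (N τ) ≥ N τ`).  This is the inequality `S_G ≤ [G:C] · S_C` of the "`Σ`-`min`"
form of Herbrand's theorem. [cite: SerreLocalFields1979, Ch. IV §1 Prop. 3 / §3 Lemma 5 (reformulated)] -/
theorem prod_max_le_prod_max_coset (C : Subgroup G) (σ : G) (U : ℝ) :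
    ∏ τ : C, max (N τ) U ≤ ∏ τ : C, max (N (σ * τ)) U := by
  obtain ⟨c, hc⟩ := exists_minRep N C σ
  rw [prod_subgroup_mul_left C (fun g => max (N g) U) σ c]
  refine Finset.prod_le_prod (fun τ _ => le_max_of_le_left (hnn τ)) (fun τ _ => ?_)
  rw [apply_mul_eq_max_of_forall_le N hmul hinv C hc τ.2]
  exact max_le_max_right U (le_max_right _ _)

/-- **`P_C(U)^{[G:C]} ≤ P_G(U)`**: the product of `max (N g) U` over the whole group dominates the
`[G:C]`-th power of the product over `C`. [cite: SerreLocalFields1979, Ch. IV §1 Prop. 3 (reformulated)] -/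
theorem prod_max_pow_index_le (C : Subgroup G) (U : ℝ) :
    (∏ τ : C, max (N τ) U) ^ Fintype.card (G ⧸ C) ≤ ∏ g : G, max (N g) U := by
  rw [prod_eq_prod_quotient_prod_subgroup C (fun g => max (N g) U), ← Finset.card_univ,
    ← Finset.prod_const]
  exact Finset.prod_le_prod (fun q _ => Finset.prod_nonneg fun τ _ => le_max_of_le_left (hnn τ))
    (fun q _ => prod_max_le_prod_max_coset N hmul hinv hnn C q.out U)

omit hinv in
/-- **From a coset lower bound to the subgroup product**: if `J ≤ ∏_{τ ∈ C} N (σ τ)` then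
`J ≤ ∏_{τ ∈ C} max (N τ) (N σ)` (since `N (σ τ) ≤ max (N σ) (N τ)`). In the application the lower
bound is Serre's divisibility `∏_{τ ∈ C} (x − στx) ∣ (y₀ − σ y₀)` for `σ ∉ C = Gal(Ω/E)`.
[cite: SerreLocalFields1979, Ch. IV §1 Prop. 3 (proof)] -/
theorem le_prod_max_of_le_prod_mul (C : Subgroup G) {σ : G} {J : ℝ}
    (hJ : J ≤ ∏ τ : C, N (σ * τ)) : J ≤ ∏ τ : C, max (N τ) (N σ) := by
  refine hJ.trans (Finset.prod_le_prod (fun τ _ => hnn _) (fun τ _ => ?_))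
  rw [max_comm]
  exact hmul σ τ

end Gauge

/-! ## `∏ max aᵢ U ≤ max (∏ aᵢ) U` on the unit interval -/

/-- For reals `aᵢ ∈ [0,1]` and `U ∈ [0,1]`: `∏ᵢ max aᵢ U ≤ max (∏ᵢ aᵢ) U` (if some `aᵢ ≤ U` the
left side is `≤ U`, otherwise it equals `∏ aᵢ`).  Multiplicative form of
`Σᵢ min (vᵢ, u) ≥ min (Σᵢ vᵢ, u)`, the inequality behind `φ_{L/K}(u) = ∫ dt/(G₀:G_t)` being
concave / the Herbrand sums `Σ_{s} min(i_G(s), u)` of Serre IV §3.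
[cite: SerreLocalFields1979, Ch. IV §3 (Herbrand sums; elementary real inequality used with Prop. 3)] -/
theorem prod_max_le_max_prod {ι : Type*} (s : Finset ι) (a : ι → ℝ) {U : ℝ}
    (hU₀ : 0 ≤ U) (hU₁ : U ≤ 1) (ha₀ : ∀ i ∈ s, 0 ≤ a i) (ha₁ : ∀ i ∈ s, a i ≤ 1) :
    ∏ i ∈ s, max (a i) U ≤ max (∏ i ∈ s, a i) U := by
  induction s using Finset.induction_on with
  | empty => simp
  | insert i s hi ih =>
    rw [Finset.prod_insert hi, Finset.prod_insert hi]
    have ha₀' : ∀ j ∈ s, 0 ≤ a j := fun j hj => ha₀ j (Finset.mem_insert_of_mem hj)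
    have ha₁' : ∀ j ∈ s, a j ≤ 1 := fun j hj => ha₁ j (Finset.mem_insert_of_mem hj)
    have hai₀ : 0 ≤ a i := ha₀ i (Finset.mem_insert_self i s)
    have hai₁ : a i ≤ 1 := ha₁ i (Finset.mem_insert_self i s)
    have hP₀ : 0 ≤ ∏ j ∈ s, max (a j) U := Finset.prod_nonneg fun j hj => le_max_of_le_left (ha₀' j hj)
    have hP₁ : ∏ j ∈ s, max (a j) U ≤ 1 :=
      Finset.prod_le_one (fun j hj => le_max_of_le_left (ha₀' j hj)) (fun j hj => max_le (ha₁' j hj) hU₁)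
    have hA₀ : 0 ≤ ∏ j ∈ s, a j := Finset.prod_nonneg ha₀'
    have ih' := ih ha₀' ha₁'
    rcases le_or_gt (a i) U with h | h
    · rw [max_eq_right h]
      calc U * ∏ j ∈ s, max (a j) U ≤ U * 1 := by gcongr
        _ = U := mul_one U
        _ ≤ max (a i * ∏ j ∈ s, a j) U := le_max_right _ _
    · rw [max_eq_left h.le]
      calc a i * ∏ j ∈ s, max (a j) U ≤ a i * max (∏ j ∈ s, a j) U := by gcongr
        _ = max (a i * ∏ j ∈ s, a j) (a i * U) := by rw [mul_max_of_nonneg _ _ hai₀]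
        _ ≤ max (a i * ∏ j ∈ s, a j) U := max_le_max_left _ (mul_le_of_le_one_left hU₀ hai₁)

/-- **Upper bound for `P_G(U)` from the cosets of a subgroup `H`**: for a gauge `N` with values in
`[0,1]` and `U ∈ [0,1]`,
`∏_{g ∈ G} max (N g) U ≤ ∏_{q ∈ G/H, q ≠ 1} max (∏_{h ∈ H} N (q.out h)) U`
(the trivial coset contributes a factor `≤ 1`, every other coset at most `max (coset product) U`).
Multiplicative form of `S_G(u) ≥ Σ_{τ̄ ≠ 1} min (Σ_{g ∈ τH} i(g), u)`.
[cite: SerreLocalFields1979, Ch. IV §1 Prop. 3 (reformulated)] -/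
theorem prod_max_univ_le_prod_quotient (N : G → ℝ) (hnn : ∀ g, 0 ≤ N g) (hle : ∀ g, N g ≤ 1)
    (H : Subgroup G) {U : ℝ} (hU₀ : 0 ≤ U) (hU₁ : U ≤ 1) :
    ∏ g : G, max (N g) U ≤
      ∏ q ∈ (Finset.univ : Finset (G ⧸ H)).erase ((1 : G) : G ⧸ H), max (∏ h : H, N (q.out * h)) U := by
  rw [prod_eq_prod_quotient_prod_subgroup H (fun g => max (N g) U),
    ← Finset.mul_prod_erase (Finset.univ : Finset (G ⧸ H)) _ (Finset.mem_univ ((1 : G) : G ⧸ H))]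
  have h1 : ∏ h : H, max (N (((1 : G) : G ⧸ H).out * h)) U ≤ 1 :=
    Finset.prod_le_one (fun h _ => le_max_of_le_left (hnn _)) (fun h _ => max_le (hle _) hU₁)
  have h0 : 0 ≤ ∏ q ∈ (Finset.univ : Finset (G ⧸ H)).erase ((1 : G) : G ⧸ H), ∏ h : H, max (N (q.out * h)) U :=
    Finset.prod_nonneg fun q _ => Finset.prod_nonneg fun h _ => le_max_of_le_left (hnn _)
  calc (∏ h : H, max (N (((1 : G) : G ⧸ H).out * h)) U) *
        ∏ q ∈ (Finset.univ : Finset (G ⧸ H)).erase ((1 : G) : G ⧸ H), ∏ h : H, max (N (q.out * h)) U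
      ≤ 1 * ∏ q ∈ (Finset.univ : Finset (G ⧸ H)).erase ((1 : G) : G ⧸ H), ∏ h : H, max (N (q.out * h)) U := by
        gcongr
    _ = ∏ q ∈ (Finset.univ : Finset (G ⧸ H)).erase ((1 : G) : G ⧸ H), ∏ h : H, max (N (q.out * h)) U := one_mul _
    _ ≤ ∏ q ∈ (Finset.univ : Finset (G ⧸ H)).erase ((1 : G) : G ⧸ H), max (∏ h : H, N (q.out * h)) U := by
        refine Finset.prod_le_prod (fun q _ => Finset.prod_nonneg fun h _ => le_max_of_le_left (hnn _))
          (fun q _ => ?_)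
        exact prod_max_le_max_prod Finset.univ (fun h : H => N (q.out * h)) hU₀ hU₁
          (fun h _ => hnn _) (fun h _ => hle _)

/-! ## The punch line -/

/-- **Monotonicity of `P_C`**: `U ≤ U' ⇒ ∏_{τ ∈ C} max (N τ) U ≤ ∏_{τ ∈ C} max (N τ) U'`.
[folklore] -/
private theorem prod_max_mono (N : G → ℝ) (hnn : ∀ g, 0 ≤ N g) (C : Subgroup G) {U U' : ℝ} (h : U ≤ U') :
    ∏ τ : C, max (N τ) U ≤ ∏ τ : C, max (N τ) U' :=
  Finset.prod_le_prod (fun _ _ => le_max_of_le_left (hnn _)) (fun _ _ => max_le_max_left _ h)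

/-- **Tate's bound, combinatorial form.** Let `N` be an ultrametric gauge on the finite group `G`
(`0 ≤ N`, `N g⁻¹ = N g`, `N (g h) ≤ max (N g) (N h)`), `C ≤ G`, and `J` a real with
`J ≤ ∏_{τ ∈ C} N (σ τ)` for every `σ ∉ C`.  If for some `U₀` the whole-group product
`∏_{g ∈ G} max (N g) U₀` is `< J^{[G:C]}`, then EVERY `σ ∉ C` has `U₀ < N σ`.
(Otherwise `J ≤ P_C(N σ) ≤ P_C(U₀)` and `P_C(U₀)^{[G:C]} ≤ P_G(U₀) < J^{[G:C]}`.)  In the application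
(`G = Gal(E(ζ_{p^n})/ℚ_p)`, `C = Gal(·/E)`, `N g = ‖g x − x‖`) this is the statement that the
elements of `Gal(E(ζ_{p^n})/ℚ_p(ζ_{p^n})) ∖ 1` move the integral generator `x` by almost units, i.e.
the decay of the different `𝔇(E(ζ_{p^n})/ℚ_p(ζ_{p^n}))` (Tate 1967 §3.2 Prop. 9, via Serre IV §1
Prop. 3) — obtained here without differents or upper numbering.
[cite: Tate1967, §3.2 Prop. 9 (combinatorial core of the proof)] -/
theorem lt_apply_of_prod_max_univ_lt (N : G → ℝ) (hnn : ∀ g, 0 ≤ N g)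
    (hmul : ∀ g h : G, N (g * h) ≤ max (N g) (N h)) (hinv : ∀ g : G, N g⁻¹ = N g)
    (C : Subgroup G) {J : ℝ} (hJ₀ : 0 ≤ J) (hJ : ∀ σ, σ ∉ C → J ≤ ∏ τ : C, N (σ * τ))
    {U₀ : ℝ} (hlt : ∏ g : G, max (N g) U₀ < J ^ Fintype.card (G ⧸ C)) {σ : G} (hσ : σ ∉ C) :
    U₀ < N σ := by
  by_contra h
  push Not at h
  have h1 : J ≤ ∏ τ : C, max (N τ) U₀ :=
    (le_prod_max_of_le_prod_mul N hmul hnn C (hJ σ hσ)).trans (prod_max_mono N hnn C h)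
  have h2 : J ^ Fintype.card (G ⧸ C) ≤ ∏ g : G, max (N g) U₀ :=
    (pow_le_pow_left₀ hJ₀ h1 _).trans (prod_max_pow_index_le N hmul hinv hnn C U₀)
  exact absurd (h2.trans_lt hlt) (lt_irrefl _)

end Literature.NumberTheory.PAdicHodge.TateAlmostEtale

end
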